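import Summits.Schanuel.Schanuel.Theorems.RootDecomp1KHeightMachine05

/-!
# RootDecomp1KLocalExponent — lens 1, generation 54, NODE 14 «THE LOCAL EXPONENT: the named targets contactC at m₀ = 2 and highContactC at m₀ = 2, 3, 4 decided hypothesis-free» (RULE K-R42 (vii′) named-target clause, K-R44, K-R45) — part 1 (RootDecomp1KLocalExponent01): §1 helpers, §2 the three local inputs

(lens-1 g54 NODE 14 HOME kernel K = HOME/decomp-schanuel-lens-1/g54/LocalExponent.lean 0a24ac98…, 1537 l, 93 thm + 7 def, imports tree …RootDecomp1KHeightMachine05 ONLY (no Literature import); Probe / Ctrl0 / Ctrl + NODE-g54.md + SHA256SUMS; CLAIM L2617, crit EX-ANTE PRICE L2618 (ONE THEOREM ×1 under RULE K-R42 (vii′), NAMED-TARGET clause of L2599, iff CHECKLIST K-g54; RULE K-R45 pre-announced: local toolkit closure + frontier certificate, census instrument LIVENESS-v4), NODE L2621 / REQUEST L2622, census STAGING NOTE 4 L2623, critic VERDICT L2624: CLEARED — THEOREM ×1 under RULE K-R42 (vii′) (named-target clause), CHECKLIST K-g54 met; RULE K-R45 FIXED (local suppliers of record; LIVENESS-v4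 = frontier certificate; unconditional part DecidedAt ∨ MachineDecidedAt ∨ LocalAt); PORT GO (verbatim; docstrings / the sanctioned privatisation only). Port by census-1 gen 22 as `RootDecomp1KLocalExponent01–06` (`--supports stmt-Schanuel-33364`; no census credit): 01 = §1 helpers + §2 the three local inputs (closed range of ℚ₂ in ℂ₂ `exists_pos_le_norm_ratCast_sub`; the 2-adic LIOUVILLE inequality at a RATIONAL centre `liouville_rat`; the nearest root with its OWN multiplicity); 02 = §3 the bounded region near a root + §4 the point (∞,∞) by its NEWTON SLOPES (`dTop`, `far_slope`, `slope_arith`, `FarClause`, `SlopeCond`, `farClause_of_slopeCond`, `farClause_of_empty`); 03 = §5 THE THEOREM **`thinFibreAt_of_localAt : LocalAt m₀ P → ThinFibreAt m₀ P`** (every m₀; `rootMult`, `RootCond`, `LocalAt`, engine `thinFibreAt_of_rootCond_farClause`, spelled-out `thinFibreAt_local`) + §5b presentation independence `localAt_iff`; 04 = §6 positioning (`localAt_of_thinThreshold_le`, `localAt_of_rootlessTop(_le)`, the tree theorems re-derived) + §7 the top Y⁵ − 1 (`padic_pow_five_eq_one`, `rootCond_two_pow_five_sub_one`) + §8 the NAMED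 TARGETS **`thinFibreAt_contact_two : ThinFibreAt 2 (xPolyP 2 contactC)`**, `thinFibreAt_highContact_three` / `_four` / `_highContact'`; 05 = §9 costume tests of the members + two refused tops; 06 = §10 **`thinFibreAt_highContact_two`** (outside the class: the critical segment v₂(r) = −N!/2 is EMPTY) + §11 bookkeeping ×0 (`LocalOffAt`, residual re-graded). PORT EDITS: the two generic one-liners `norm_natCast_le_one_Cp` / `norm_intCast_le_one_Cp` PRIVATISED (head dry-run dedup.foreign notes vs Summit.ABC… / Summit.BirchSwinnertonDyer… twins; file-local copies re-emitted where used); otherwise none on declarations (K fully documented; no set_option / cite-token); provenance doc blocks + continuation headers = K's own open-lines only; statements and proofs VERBATIM. Rung 0 — nothing here proves Schanuel, 33364, 33363, 31077 or ThinFibre 2; the class `LocalAt` and the named targets are HYPOTHESIS-FREE, §11 is conditional on PadicSubspace / HeightComparison.)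
-/

/-!
# RootDecomp1KLocalExponent — lens 1, generation 54, node 14 «THE LOCAL EXPONENT»
  (RULE K-R42 (vii′) NAMED-TARGET clause of L2599; RULE K-R44 member liveness; CLAIM L2617, EX-ANTE PRICE L2618)

HONEST SCOPE (line 1).  ONE theorem-package on the K-line's thin-fibre residual `ThinFibreAt m₀ P` (tree
`RootDecomp1KDegreeLadder.ThinFibreAt`, DegreeLadder06) with NO binder, NO hypothesis `def … : Prop`, NO Literature
fact assumed and NO NEW DIOPHANTINE INPUT: every supplier is local and elementary — Gauss/valuation ladders, the
ultrametric Newton polygon of the level identity at `(∞,∞)`, the closed range of `ℚ₂` in `ℂ₂`, the tree's per-root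
RIDOUT WINDOW (`RootDecomp1KXAll.ridout_window_pow`, exponent `2μ+1`), the `2`-adic LIOUVILLE inequality at a
RATIONAL centre (exponent `μ+1`, proved here in five lines from `|num·den' − num'·den| ≥ 1`), and residue / unit
arithmetic in `ℚ₂` for the two named tops.  Rung count 0; NO ∀-item moves: 33364 / 33363 / 31077 / 31987 / `Schanuel`
UNMOVED; `ThinFibre 2` NOT proved; `PadicSubspace`, `HeightComparison`, `SiegelShapesOffAt 2`, `MachineOffAt 2` untouched.
PRIOR ART inside the cell (h3): lens-1 g47 node 6 (`XFree.lean`, ×0 of record) removed the threshold for `k = 1` with the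
same rational-centre idea; node 14 is its every-`k` form WITH the slope datum and the class predicate, priced ex ante ONLY for
the named targets + corollary structure (L2618).  (h5): the critic's L2599 expectation «an emptiness theorem for `contactC` at
`2`» was WITHDRAWN by PRICE L2618 — `contactC` is decided here by the rational-centre storey, not by emptiness; emptiness IS
used, and only, for `highContactC` at `m₀ = 2` (§10).

* THE CLASS (`def`, a predicate ON `P`, census convention «datum def»): `LocalAt m₀ P := ∃ k c, c k ≠ 0 ∧ P = xPolyP k c ∧
  RootCond m₀ (c k) ∧ SlopeCond m₀ k c`, where for `B : ℤ[X]`, `rootMult B β := rootMultiplicity β (B.map (algebraMap ℤ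
  (PadicAlgCl 2)))` (multiplicity of `β ∈ ℂ₂` as a root of the image of `B` in `ℂ₂[Y]`),
  (R) `RootCond m₀ B := ∀ β : PadicAlgCl 2, aeval β B = 0 → (i) (∀ y : ℚ_[2], algebraMap ℚ_[2] (PadicAlgCl 2) y ≠ β) ∨
      (ii) (∃ q : ℚ, (q : PadicAlgCl 2) = β ∧ rootMult B β + 1 ≤ m₀) ∨ (iii) 2 * rootMult B β + 1 ≤ m₀`,
  (S) `SlopeCond m₀ k c := ∀ j, j < k → (c k).natDegree < (c j).natDegree → (c j).natDegree - (c k).natDegree < m₀ * (k - j)`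
      (the ℕ-subtractions are GUARDED by the two hypotheses; every Newton slope `(k − j)/(deg c_j − deg c_k)` at `(∞,∞)`
      exceeds `1/m₀`; indices with `deg c_j ≤ deg c_k` carry no far point at all, `far_slope`).
  PRESENTATION INDEPENDENCE `localAt_iff : LocalAt m₀ P ↔ P ≠ 0 ∧ RootCond m₀ (topX P) ∧ SlopeCond m₀ (xdeg P) (xCoeff P)`
  (tree intrinsics `RootDecomp1KXAll.topX / xdeg / xCoeff`); monotone in `m₀` (`localAt_mono`).
* THE THEOREM `thinFibreAt_of_localAt : LocalAt m₀ P → ThinFibreAt m₀ P` for EVERY `m₀ : ℕ` — no `2 ≤ m₀`, no `Prime P`,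
  no separability, any `x`-degree `k`, any multiplicities.  (`LocalAt 0 P` admits exactly: `c_k` has NO root in `ℚ₂` and
  `deg c_j ≤ deg c_k` for all `j < k` — then the levels are eventually EMPTY on bounded `2`-adic balls and beyond, and the
  clause holds vacuously; `LocalAt 1 P`: roots of `c_k` all outside `ℚ₂` ((ii)/(iii) need `μ = 0`, impossible for a root)
  and `deg c_j − deg c_k < k − j`.)  Spelled-out form `thinFibreAt_local` (binders (R), (S) verbatim); the ENGINE behind
  it, `thinFibreAt_of_rootCond_farClause : c k ≠ 0 → RootCond m₀ (c k) → FarClause m₀ k c → ThinFibreAt m₀ (xPolyP k c)`,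
  separates the bounded region (per root: (i) closed range `exists_pos_le_norm_ratCast_sub`; (ii) `liouville_rat` + the
  tree's `infinity_arith`, the centre itself sits on finitely many levels by `levels_finite_of_nondeg`; (iii) the tree's
  `ridout_window_pow` + `dichotomy_arith_mult`) from the FAR CLAUSE `FarClause m₀ k c` (beyond some `2`-adic radius the
  clause holds eventually), supplied by (S) (`farClause_of_slopeCond`: `far_slope` + `slope_arith`, using only
  `den r ≥ ‖r‖₂`) or by EMPTINESS of the far region (`farClause_of_empty`).
* POSITIONING (§6): node 5's threshold class and node 10's rootless-top class are SUB-CLASSES —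
  `localAt_of_thinThreshold_le : P ≠ 0 → thinThreshold P ≤ m₀ → LocalAt m₀ P`, `localAt_of_rootlessTop : RootlessTop e P →
  LocalAt (e + 1) P` (`localAt_of_rootlessTop_le` with `e + 1 ≤ m₀`) — and the tree's `thinFibreAt_all` /
  `thinFibreAt_of_rootlessTop` are re-derived as one-line corollaries (`thinFibreAt_all_again`,
  `thinFibreAt_of_rootlessTop_again`).
* NAMED TARGETS, HYPOTHESIS-FREE (§8, §10): `thinFibreAt_contact_two : ThinFibreAt 2 (xPolyP 2 contactC)` (tree: `3 ≤ m₀`;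
  census v47 (i) / LIVENESS-v3 row 16: FRONTIER at `2` before this node), `thinFibreAt_highContact_three / _four` and
  `thinFibreAt_highContact' : 3 ≤ m₀ → …` (tree: `5 ≤ m₀`) — all MEMBERS of the class (`localAt_contact : 2 ≤ m₀ → LocalAt m₀
  (xPolyP 2 contactC)`, `localAt_highContact : 3 ≤ m₀ → …`; top `Y⁵ − 1`: its only root in `ℚ₂` is the simple RATIONAL root
  `1`, `padic_pow_five_eq_one`, so (R) holds at `m₀ = 2` by (ii)+(i), `rootCond_two_pow_five_sub_one`; slopes `1` resp.
  `1/2`); and the RISK ITEM `thinFibreAt_highContact_two : ThinFibreAt 2 (xPolyP 2 highContactC)` decided OUTSIDE the class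
  (`not_localAt_two_highContact`: the slope `1/2` is CRITICAL at `m₀ = 2`) by the engine + `farClause_of_empty` +
  `highContact_far_empty` (for `N ≥ 3` NO level point has `‖r‖₂ > 1`: on the critical segment `s = 2^{N!/2} r` would be a
  rational unit with `‖p_N² + s⁴‖₂ = 1/2 ≤ 2^{−5N!/2}`, absurd); hence `thinFibreAt_highContact_all : 2 ≤ m₀ → …`.
* COSTUME / POSITION BY NAME (§9): `thinThreshold (xPolyP 2 contactC) = 3`, `… highContactC = 5`; `¬ DecidedAt 2 (xPolyP 2
  contactC)`, `¬ DecidedAt m₀ (xPolyP 2 highContactC)` for `m₀ ≤ 4`; `¬ SepTopAt 2 (… contactC)`, `¬ SepTopAt m₀ (… highContactC)`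
  for `m₀ ≤ 4` (node 11's class mod `PadicSubspace` does not reach them there either); not `RootlessTop e` for any `e`; not
  two-term (`contact_ne_twoTermP`, `highContact_ne_twoTermP`); not affine / x-linear (tree `contact_not_xLinear`,
  here `highContact_not_xLinear`).  K-R44 liveness certificates: census LIVENESS-v4 rows `contactC`, `highContactC` (cited in
  NODE-g54.md; NOT formalised — `¬ CorrAt / ¬ ParamAt` are not tree-decidable statements).
* REFUSED tops / presentations, as THEOREMS (critic's (c-α)–(c-δ), doubled by planted controls in LocalExponentCtrl.lean):
  `not_rootCond_two_sq : ¬ RootCond 2 ((X − C 1)^2)` (rational DOUBLE root: `μ + 1 = 3 > 2`; accepted at `3`,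
  `rootCond_three_sq`), `not_localAt_two_M17P : ¬ LocalAt 2 M17P` (top `Y² − 17`: simple IRRATIONAL `ℚ₂`-roots, `2μ + 1 = 3 > 2`
  — node 11's Subspace member stays FRONTIER), `not_slopeCond_two_highContact` (critical presentation `deg c₀ − deg c₂ = 4 =
  2·2`), `not_localAt_two_highContact`.

WHAT IS NOT PROVED (line 2).  Nothing uniform: not `ThinFibre 2`, not `SiegelShapesOffAt 2` / `MachineOffAt 2`, no ∀-item,
not Schanuel.  The class is NOT closed under the missing cases, which are exactly the OPEN TERRITORY at quality `m₀` in this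
node's currency: pairs `(m₀, P)` with a K-R44-LIVE `ℚ₂`-branch of provable local exponent `≤ 1/m₀` — an IRRATIONAL `ℚ₂`-root
`β` of `topX P` with `m₀ ≤ 2μ_β` (Ridout-critical: the `PadicSubspace` line, e.g. `M17P`, `L17P` at `2`), a RATIONAL root with
`m₀ ≤ μ_β` (Liouville-critical), or a LIVE `(∞,∞)`-segment of slope `σ ≤ 1/m₀` (needs a polynomial-specific emptiness or a
genuinely new Diophantine input; generic Ridout at a critical segment is killed by the archimedean size).  After this node the
UNCONDITIONAL part of the K-line at `m₀` reads `DecidedAt m₀ ∨ MachineDecidedAt m₀ ∨ LocalAt m₀` (+ the emptiness-decided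
member `highContactC` at `2`).

Sections: §1 norms/monotonicity · §2 the three local inputs (closed range; `2`-adic Liouville at a rational centre; nearest
root with its own multiplicity) · §3 bounded region · §4 Newton slopes at `(∞,∞)`, `FarClause`, `SlopeCond`, suppliers ·
§5 `RootCond`, THE ENGINE, `LocalAt`, THE THEOREM · §5b presentation independence · §6 positioning (nodes 5, 10 as
corollaries) · §7 the top `Y⁵ − 1` over `ℚ₂` · §8 members = named targets · §9 costume tests and refused tops · §10
`highContactC` at `m₀ = 2` by the EMPTY critical segment · §11 bookkeeping (×0): the residual re-graded `LocalOffAt m₀`,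
`thinFibre_of_localOffAt : 2 ≤ m₀ → LocalOffAt m₀ → ThinFibre m₀`.
Imports: the tree's K-line port `RootDecomp1KHeightMachine05` ONLY (transitively XTop, XAll, XLinear, LevelFinite,
SubspaceBranch, DegreeLadder); no Literature import; namespace `…RootDecomp1KLocalExponent`; no `sorry`, no `axiom`, no
`instance`, no `private`, no `set_option`, no notation.
-/

noncomputable section

namespace Summit.Schanuel.Schanuel.Theorems.RootDecomp1KLocalExponent

open Polynomial LiouvilleNumber
open scoped Nat
open Summit.Schanuel.Schanuel.Theorems.RootDecomp1KTwoBaseCell (psNumer partialSum_eq_psNumer_div coprime_psNumer)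
open Summit.Schanuel.Schanuel.Theorems.RootDecomp1KRelLiouvilleCell (partialSum_two_strictMono)
open Summit.Schanuel.Schanuel.Theorems.RootDecomp1KDegreeLadder
open Summit.Schanuel.Schanuel.Theorems.RootDecomp1KXLinearCore
open Summit.Schanuel.Schanuel.Theorems.RootDecomp1KXLinear
open Summit.Schanuel.Schanuel.Theorems.RootDecomp1KXLinearII
open Summit.Schanuel.Schanuel.Theorems.RootDecomp1KXTop
open Summit.Schanuel.Schanuel.Theorems.RootDecomp1KXAll
open Summit.Schanuel.Schanuel.Theorems.RootDecomp1KLevelFinite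
open Summit.Schanuel.Schanuel.Theorems.RootDecomp1KSubspaceBranch
open Summit.Schanuel.Schanuel.Theorems.RootDecomp1KHeightMachine

/-! ## §1  Helpers: `2`-adic norms of `2`, integers, naturals; monotonicity of `ThinFibreAt` -/

/-- `‖2‖₂ = 1/2` in `ℂ₂`. -/
theorem norm_two_Cp : ‖(2 : PadicAlgCl 2)‖ = 1 / 2 := by
  have h1 : ((2 : ℕ) : PadicAlgCl 2) = algebraMap ℚ_[2] (PadicAlgCl 2) ((2 : ℕ) : ℚ_[2]) :=
    (map_natCast _ 2).symm
  have h2 : ‖((2 : ℕ) : ℚ_[2])‖ = (↑(2 : ℕ) : ℝ)⁻¹ := Padic.norm_p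
  have h3 : ‖((2 : ℕ) : PadicAlgCl 2)‖ = 1 / 2 := by rw [h1, PadicAlgCl.norm_extends, h2]; norm_num
  simpa using h3

/-- `‖2^t‖₂ = 2^{−t}`. -/
theorem norm_two_pow_Cp (t : ℕ) : ‖(2 : PadicAlgCl 2) ^ t‖ = (1 / 2 : ℝ) ^ t := by
  rw [norm_pow, norm_two_Cp]

/-- `‖z‖₂ ≤ 1` for integers. -/
private theorem norm_intCast_le_one_Cp (z : ℤ) : ‖(z : PadicAlgCl 2)‖ ≤ 1 := by
  have h1 : (z : PadicAlgCl 2) = algebraMap ℚ_[2] (PadicAlgCl 2) (z : ℚ_[2]) := (map_intCast _ z).symm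
  rw [h1, PadicAlgCl.norm_extends]
  exact Padic.norm_int_le_one z

/-- `‖n‖₂ ≤ 1` for naturals. -/
private theorem norm_natCast_le_one_Cp (n : ℕ) : ‖(n : PadicAlgCl 2)‖ ≤ 1 := by
  have h := norm_intCast_le_one_Cp (n : ℤ)
  rwa [Int.cast_natCast] at h

/-- a rational is in the image of `ℚ₂`. -/
theorem ratCast_mem_range (r : ℚ) : (r : PadicAlgCl 2) = algebraMap ℚ_[2] (PadicAlgCl 2) (r : ℚ_[2]) :=
  (map_ratCast _ r).symm

/-- `ThinFibreAt` is monotone in the quality `m₀` (the tree has `ThinFibre.mono` only). -/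
theorem thinFibreAt_mono {m₀ m₁ : ℕ} (h : m₀ ≤ m₁) {P : ℤ[X][X]} (hP : ThinFibreAt m₀ P) : ThinFibreAt m₁ P := by
  intro C
  obtain ⟨N₀, hN₀⟩ := hP C
  refine ⟨N₀, fun N hN r hr hPr hnd => ?_⟩
  have hd1 : (1 : ℝ) ≤ r.den := by exact_mod_cast Nat.succ_le_of_lt r.den_pos
  exact (hN₀ N hN r hr hPr hnd).trans_le (pow_le_pow_right₀ hd1 (Nat.mul_le_mul_right _ h))

/-! ## §2  The three local inputs

### §2.1  A root OUTSIDE `ℚ₂` repels every rational (the image of `ℚ₂` in `ℂ₂` is closed) -/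

/-- the image of `ℚ₂` in `ℂ₂` is closed (an isometric image of a complete space). -/
theorem isClosed_range_padic : IsClosed (Set.range (algebraMap ℚ_[2] (PadicAlgCl 2))) := by
  have hiso : Isometry (algebraMap ℚ_[2] (PadicAlgCl 2)) :=
    AddMonoidHomClass.isometry_of_norm _ (PadicAlgCl.norm_extends (p := 2))
  exact hiso.isUniformInducing.isComplete_range.isClosed

/-- **input (i)**: a point `β ∈ ℂ₂` outside `ℚ₂` is at positive distance from all rationals. -/
theorem exists_pos_le_norm_ratCast_sub (β : PadicAlgCl 2)
    (hβ : ∀ y : ℚ_[2], algebraMap ℚ_[2] (PadicAlgCl 2) y ≠ β) :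
    ∃ δ : ℝ, 0 < δ ∧ ∀ r : ℚ, δ ≤ ‖(r : PadicAlgCl 2) - β‖ := by
  have hnot : β ∉ Set.range (algebraMap ℚ_[2] (PadicAlgCl 2)) := by
    rintro ⟨y, hy⟩; exact hβ y hy
  have hopen : IsOpen (Set.range (algebraMap ℚ_[2] (PadicAlgCl 2)))ᶜ := isClosed_range_padic.isOpen_compl
  obtain ⟨δ, hδ, hball⟩ := Metric.isOpen_iff.mp hopen β hnot
  refine ⟨δ, hδ, fun r => ?_⟩
  by_contra hlt
  push Not at hlt
  have hmem : (r : PadicAlgCl 2) ∈ Metric.ball β δ := by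
    rw [Metric.mem_ball, dist_eq_norm]; exact hlt
  exact hball hmem ⟨(r : ℚ_[2]), (ratCast_mem_range r).symm⟩

/-! ### §2.2  The `2`-adic LIOUVILLE inequality at a RATIONAL centre -/

/-- `1/|m| ≤ ‖m‖₂` for a non-zero integer `m` (`2^{v₂(m)} ≤ |m|`). -/
theorem one_div_abs_le_norm_intCast (m : ℤ) (hm : m ≠ 0) : 1 / |(m : ℝ)| ≤ ‖(m : PadicAlgCl 2)‖ := by
  have hQ : ((m : ℚ) : PadicAlgCl 2) = (m : PadicAlgCl 2) := by push_cast; rfl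
  have hm' : (m : ℚ) ≠ 0 := by exact_mod_cast hm
  rw [← hQ, norm_ratCast_two hm', padicValRat.of_int]
  have hv : ((2 : ℕ) ^ padicValInt 2 m : ℕ) ≤ m.natAbs := by
    unfold padicValInt
    exact Nat.le_of_dvd (Int.natAbs_pos.mpr hm) pow_padicValNat_dvd
  have hvR : (2 : ℝ) ^ padicValInt 2 m ≤ |(m : ℝ)| := by
    have h1 : ((2 ^ padicValInt 2 m : ℕ) : ℝ) ≤ ((m.natAbs : ℕ) : ℝ) := by exact_mod_cast hv
    have h2 : ((m.natAbs : ℕ) : ℝ) = |(m : ℝ)| := by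
      rw [Nat.cast_natAbs, Int.cast_abs]
    rw [← h2]; push_cast at h1; exact h1
  have hpos : (0 : ℝ) < |(m : ℝ)| := abs_pos.mpr (by exact_mod_cast hm)
  rw [zpow_neg, zpow_natCast, one_div]
  exact inv_anti₀ (by positivity) hvR

/-- **input (ii)**: the `2`-adic LIOUVILLE inequality at a rational centre `q`: for rationals `r ≠ q` in the
window `|r| ≤ C`, `κ / den r ≤ ‖r − q‖₂` with `κ = κ(q, C) > 0` (`|num(r − q)| ≥ 1`). -/
theorem liouville_rat (q : ℚ) (C : ℝ) : ∃ κ : ℝ, 0 < κ ∧ ∀ r : ℚ, r ≠ q → |(r : ℝ)| ≤ C →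
    κ / r.den ≤ ‖(r : PadicAlgCl 2) - (q : PadicAlgCl 2)‖ := by
  set A : ℝ := |C| * q.den + |(q.num : ℝ)| with hA
  have hA0 : 0 ≤ A := by positivity
  refine ⟨1 / (A + 1), by positivity, fun r hrq hrC => ?_⟩
  set m : ℤ := r.num * q.den - q.num * r.den with hmdef
  have hrq' : (r : ℚ) - q = (m : ℚ) / ((r.den : ℚ) * q.den) := by
    have hr := Rat.num_div_den r
    have hq := Rat.num_div_den q
    have hrd : (r.den : ℚ) ≠ 0 := by exact_mod_cast r.den_nz
    have hqd : (q.den : ℚ) ≠ 0 := by exact_mod_cast q.den_nz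
    rw [hmdef]; push_cast
    conv_lhs => rw [← hr, ← hq]
    field_simp
  have hm0 : m ≠ 0 := by
    intro h0
    have : (r : ℚ) - q = 0 := by rw [hrq', h0]; simp
    exact hrq (sub_eq_zero.mp this)
  -- `|m| ≤ A · den r`
  have hnum : |(r.num : ℝ)| ≤ |C| * r.den := by
    have h1 : (r.num : ℝ) = (r : ℝ) * r.den := by
      have := Rat.num_div_den r
      have hrd : (r.den : ℝ) ≠ 0 := by exact_mod_cast r.den_nz
      have h2 : ((r.num : ℚ) : ℝ) / ((r.den : ℚ) : ℝ) = (r : ℝ) := by exact_mod_cast this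
      push_cast at h2
      field_simp at h2
      linarith [h2]
    rw [h1, abs_mul, Nat.abs_cast]
    exact mul_le_mul_of_nonneg_right (hrC.trans (le_abs_self C)) (Nat.cast_nonneg _)
  have hmle : |(m : ℝ)| ≤ A * r.den := by
    rw [hmdef]; push_cast
    calc |(r.num : ℝ) * q.den - q.num * r.den| ≤ |(r.num : ℝ) * q.den| + |(q.num : ℝ) * r.den| := abs_sub _ _
      _ = |(r.num : ℝ)| * q.den + |(q.num : ℝ)| * r.den := by
          rw [abs_mul, abs_mul, Nat.abs_cast, Nat.abs_cast]
      _ ≤ |C| * r.den * q.den + |(q.num : ℝ)| * r.den := by gcongr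
      _ = A * r.den := by rw [hA]; ring
  have hmpos : (0 : ℝ) < |(m : ℝ)| := abs_pos.mpr (by exact_mod_cast hm0)
  have hden : (0 : ℝ) < r.den := by exact_mod_cast r.den_pos
  -- `‖r − q‖₂ ≥ ‖m‖₂ ≥ 1/|m| ≥ 1/((A+1)·den r)`
  have hcast : (r : PadicAlgCl 2) - (q : PadicAlgCl 2) =
      (m : PadicAlgCl 2) / (((r.den : ℚ) * q.den : ℚ) : PadicAlgCl 2) := by
    have := congrArg (fun t : ℚ => (t : PadicAlgCl 2)) hrq'
    push_cast at this ⊢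
    exact this
  have hD1 : ‖(((r.den : ℚ) * q.den : ℚ) : PadicAlgCl 2)‖ ≤ 1 := by
    push_cast
    rw [norm_mul]
    exact mul_le_one₀ (norm_natCast_le_one_Cp _) (norm_nonneg _) (norm_natCast_le_one_Cp _)
  have hD0 : 0 < ‖(((r.den : ℚ) * q.den : ℚ) : PadicAlgCl 2)‖ := by
    rw [norm_pos_iff]
    push_cast
    exact mul_ne_zero (by exact_mod_cast r.den_nz) (by exact_mod_cast q.den_nz)
  have hge : ‖(m : PadicAlgCl 2)‖ ≤ ‖(r : PadicAlgCl 2) - (q : PadicAlgCl 2)‖ := by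
    rw [hcast, norm_div]
    rw [le_div_iff₀ hD0]
    calc ‖(m : PadicAlgCl 2)‖ * ‖(((r.den : ℚ) * q.den : ℚ) : PadicAlgCl 2)‖ ≤ ‖(m : PadicAlgCl 2)‖ * 1 := by
          gcongr
      _ = ‖(m : PadicAlgCl 2)‖ := mul_one _
  refine le_trans ?_ ((one_div_abs_le_norm_intCast m hm0).trans hge)
  rw [div_div, one_div_le_one_div (by positivity) hmpos]
  calc |(m : ℝ)| ≤ A * r.den := hmle
    _ ≤ (A + 1) * r.den := by nlinarith

/-! ### §2.3  The nearest root WITH ITS OWN multiplicity (lens-1 g47 §XV.1, all of it elementary) -/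

/-- **Nearest root, sharp form**: every `z ∈ ℂ₂` has a root `β ∈ T` of `B` with `(min 1 ‖z − β‖)^{n β} ≤ c·‖B(z)‖`,
where `n β = rootMultiplicity β B` is the multiplicity of THAT root (the tree's `nearest_root_mult` states the
exponent `μ = max n`). -/
theorem nearest_root_sharp (B : ℤ[X]) (hb : 1 ≤ B.natDegree) :
    ∃ (T : Finset (PadicAlgCl 2)) (n : PadicAlgCl 2 → ℕ) (c : ℝ), 0 < c ∧ (∀ β ∈ T, aeval β B = 0) ∧
      (∀ β ∈ T, 1 ≤ n β) ∧ (∀ β, n β = rootMultiplicity β (B.map (algebraMap ℤ (PadicAlgCl 2)))) ∧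
      (∑ β ∈ T, n β = B.natDegree) ∧
      (∀ z : PadicAlgCl 2, aeval z B = (B.leadingCoeff : PadicAlgCl 2) * ∏ β ∈ T, (z - β) ^ n β) ∧
      ∀ z : PadicAlgCl 2, ∃ β ∈ T, min 1 ‖z - β‖ ^ n β ≤ c * ‖aeval z B‖ := by
  classical
  have hB : B ≠ 0 := by rintro rfl; simp at hb
  obtain ⟨T, n, hroots, hn1, hnmult, hsum, hprod⟩ := roots_data_mult B hB
  have hne : T.Nonempty := by
    rw [Finset.nonempty_iff_ne_empty]
    rintro rfl
    rw [Finset.sum_empty] at hsum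
    omega
  have hℓ : (0 : ℝ) < ‖(B.leadingCoeff : PadicAlgCl 2)‖ := by
    rw [norm_pos_iff]; exact_mod_cast leadingCoeff_ne_zero.mpr hB
  set D : PadicAlgCl 2 → ℝ := fun β₀ => ∏ β ∈ T.erase β₀, ‖β₀ - β‖ ^ n β with hD
  have hDpos : ∀ β₀ ∈ T, 0 < D β₀ := by
    intro β₀ hβ₀
    apply Finset.prod_pos
    intro β hβ
    apply pow_pos
    rw [norm_pos_iff, sub_ne_zero]
    exact (Finset.ne_of_mem_erase hβ).symm
  set c : ℝ := ∑ β₀ ∈ T, 1 / (‖(B.leadingCoeff : PadicAlgCl 2)‖ * D β₀) with hc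
  have hcpos : 0 < c :=
    Finset.sum_pos (fun β₀ hβ₀ => one_div_pos.mpr (mul_pos hℓ (hDpos β₀ hβ₀))) hne
  refine ⟨T, n, c, hcpos, hroots, hn1, hnmult, hsum, hprod, fun z => ?_⟩
  obtain ⟨β₀, hβ₀T, hmin⟩ := T.exists_min_image (fun β => ‖z - β‖) hne
  refine ⟨β₀, hβ₀T, ?_⟩
  have hfac : ∀ β ∈ T.erase β₀, ‖β₀ - β‖ ^ n β ≤ ‖z - β‖ ^ n β := by
    intro β hβ
    have hβT : β ∈ T := Finset.mem_of_mem_erase hβ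
    have h1 := IsUltrametricDist.norm_add_le_max (z - β) (-(z - β₀))
    rw [norm_neg, ← sub_eq_add_neg, show z - β - (z - β₀) = β₀ - β by ring] at h1
    exact pow_le_pow_left₀ (norm_nonneg _) (h1.trans (max_le le_rfl (hmin β hβT))) _
  have hlow : ‖(B.leadingCoeff : PadicAlgCl 2)‖ * (‖z - β₀‖ ^ n β₀ * D β₀) ≤ ‖aeval z B‖ := by
    rw [hprod z, norm_mul, norm_prod]
    simp only [norm_pow]
    rw [← Finset.mul_prod_erase T (fun β => ‖z - β‖ ^ n β) hβ₀T]
    refine mul_le_mul_of_nonneg_left (mul_le_mul_of_nonneg_left ?_ (by positivity)) hℓ.le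
    exact Finset.prod_le_prod (fun β _ => by positivity) hfac
  have hkey : ‖z - β₀‖ ^ n β₀ ≤ 1 / (‖(B.leadingCoeff : PadicAlgCl 2)‖ * D β₀) * ‖aeval z B‖ := by
    have hpos : 0 < ‖(B.leadingCoeff : PadicAlgCl 2)‖ * D β₀ := mul_pos hℓ (hDpos β₀ hβ₀T)
    rw [one_div, ← div_eq_inv_mul, le_div_iff₀ hpos]
    calc ‖z - β₀‖ ^ n β₀ * (‖(B.leadingCoeff : PadicAlgCl 2)‖ * D β₀)
        = ‖(B.leadingCoeff : PadicAlgCl 2)‖ * (‖z - β₀‖ ^ n β₀ * D β₀) := by ring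
      _ ≤ ‖aeval z B‖ := hlow
  have hmin1 : min 1 ‖z - β₀‖ ^ n β₀ ≤ ‖z - β₀‖ ^ n β₀ :=
    pow_le_pow_left₀ (le_min zero_le_one (norm_nonneg _)) (min_le_right _ _) _
  refine hmin1.trans (hkey.trans (mul_le_mul_of_nonneg_right ?_ (norm_nonneg _)))
  exact Finset.single_le_sum (f := fun β₀ => 1 / (‖(B.leadingCoeff : PadicAlgCl 2)‖ * D β₀))
    (fun β₀ hβ₀ => (one_div_pos.mpr (mul_pos hℓ (hDpos β₀ hβ₀))).le) hβ₀T

end Summit.Schanuel.Schanuel.Theorems.RootDecomp1KLocalExponent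

end
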